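import Summits.QuantumFields.BalabanUV.T4Continuum.Support.CoordOctantBoxes

/-!
# `BalabanUV.T4Continuum.Support.CoordAnnulusPoincare` — NE2 (node U1a) formalisation swarm, sub-row `T4-U1a.S-NE2-D1-DIRICHLET°`,
# supplier item «Δ1-HOLEFILL» (brick H-B, part 3b of 3): THE POINCARÉ INEQUALITY WITH A VANISHING OCTANT ON THE CUBE ANNULUS
# `[0,4k)^d ∖ [k,3k)^d` — «mass on the `2d` slabs ≤ annConst(d)·(n(n+1)/2)·(sum of the slab Dirichlet forms)» — and «slab forms ≤ d·(energy
# outside the inner cube)» (unit b2b-balaban-t4-ne2-formalise-leaf-08, gen 6, file 3b)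

HONEST FRAMING.  Rung (B)+1 bookkeeping at MODEL level; [folklore] finite lattice calculus; NE2 (U1a) is NOT proved by this file; spine
PROVED 0/9 unchanged; NOT infinite volume, NOT the mass gap, NOT Clay.  HONEST DEPENDENCY (verbatim): «continuum YM on T⁴ ⇐ BetaPertH ∧ nine
spine estimates (0/9 proved); BetaPertH ⇐ (D1) ∧ (D4) ∧ CAP+tail; G-an2-4 gates asym, D1 and NE2/3/4.»

WHAT THIS FILE PROVES (0 sorry).  On `Fin d → Fin (n+1)` with `4k = n + 1`, octant `oct σ k` (`CoordOctantBoxes`), slabs `lo μ k` ∕ `hi μ k`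
(`CoordSlabPoincare(Hi)`):
 * §3 `xsl`∕`fsl` (the σ-side ∕ far slab of a direction), `slabDir k F = Σ_μ (dirOn (lo μ k) F + dirOn (hi μ k) F)`;
   **`annulus_mass_le`**: `F = 0` on `oct σ k`, `d ≥ 2` ⇒ `Σ_μ (Σ_{lo μ k} ‖F‖² + Σ_{hi μ k} ‖F‖²) ≤ annConst d · (n(n+1)/2) · slabDir k F`,
   `annConst d = d·(133 + 6·2^d)` — σ-side slabs by `FiniteVarianceGluing.sum_norm_sq_le_of_vanish` (vanishing box `octT`, ratio ≤ 2^{d+1}),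
   far slabs GLUED to an orthogonal σ-side slab (`…_of_gluing`, overlap box `octW`, ratio ≤ 16), slab Poincaré `cvar_lo_le` ∕ `cvar_hi_le`;
 * §4 **`slabs_dir_le`**: `slabDir k F ≤ d·(dirOn univ F − dirOn (inner k) F)`, `inner k = [k,3k)^d` — bondwise: a slab bond is not an inner
   bond, the two slabs of one direction are disjoint, a bond lies in at most `d` slabs.  So the annulus mass is paid by the energy OUTSIDE the
   inner cube — the hole to be filled (file 4, `DirichletHoleFilling`).  Constants explicit and generous (no optimality attempted).

ABSOLUTE RULE (cell, verbatim): «No internally-minted statement may enter as a cited fact. Every hypothesis is either kernel-proved in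
this package or a verbatim quotation of a PUBLISHED theorem with page reference. The manuscript(s) under audit are NOT citable for
their own disputed steps — they are the thing under adjudication; programme-internal (2001/route/tribunal) claims are never citable.»
[folklore]; plain data `def`s, no `def … : Prop` fact.  NOT CLAIMED: anything analytic; NE2.
-/

noncomputable section

open scoped BigOperators ComplexConjugate
open Finset

namespace Summit.QuantumFields.BalabanUV.T4Continuum.CoordAnnulusPoincare

open Literature.MathematicalPhysics.QuantumFieldTheory.Balaban1983to89.Beta.CoordCubePoincare (stepUp)
open Summit.QuantumFields.BalabanUV.T4Continuum.FiniteVarianceGluing (cvar cvar_nonneg sum_norm_sq_le_of_vanish sum_norm_sq_le_of_gluing)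
open Summit.QuantumFields.BalabanUV.T4Continuum.CoordSlabPoincare
open Summit.QuantumFields.BalabanUV.T4Continuum.CoordSlabPoincareHi (hi mem_hi cvar_hi_le)
open Summit.QuantumFields.BalabanUV.T4Continuum.CoordOctantBoxes

variable {n d : ℕ}

/-! ## §3 The annulus with a vanishing octant -/

section Annulus

variable (k : ℕ) (σ : Fin d → Bool)

/-- the σ-SIDE slab in direction `μ` (the one meeting the octant). [folklore] -/
def xsl (μ : Fin d) : Finset (Fin d → Fin (n + 1)) := if σ μ then hi (n := n) μ k else lo (n := n) μ k

/-- the FAR slab in direction `μ`. [folklore] -/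
def fsl (μ : Fin d) : Finset (Fin d → Fin (n + 1)) := if σ μ then lo (n := n) μ k else hi (n := n) μ k

/-- the sum of ALL slab Dirichlet forms (the right-hand side of the annulus inequality). [folklore] -/
def slabDir (F : (Fin d → Fin (n + 1)) → ℂ) : ℝ := ∑ μ : Fin d, (dirOn (lo (n := n) μ k) F + dirOn (hi (n := n) μ k) F)

omit σ in
/-- `slabDir ≥ 0`. [folklore] -/
theorem slabDir_nonneg (F : (Fin d → Fin (n + 1)) → ℂ) : 0 ≤ slabDir (n := n) k F :=
  Finset.sum_nonneg fun _ _ => add_nonneg (dirOn_nonneg _ _) (dirOn_nonneg _ _)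

/-- the two slabs of direction `μ` are the σ-side one and the far one. [folklore] -/
theorem mass_lo_add_hi (μ : Fin d) (F : (Fin d → Fin (n + 1)) → ℂ) :
    ∑ y ∈ lo (n := n) μ k, ‖F y‖ ^ 2 + ∑ y ∈ hi (n := n) μ k, ‖F y‖ ^ 2
      = ∑ y ∈ xsl (n := n) k σ μ, ‖F y‖ ^ 2 + ∑ y ∈ fsl (n := n) k σ μ, ‖F y‖ ^ 2 := by
  unfold xsl fsl; cases σ μ <;> simp [add_comm]

/-- slab Poincaré for the σ-side slab. [folklore] -/
theorem cvar_xsl_le (hk : 4 * k = n + 1) (μ : Fin d) (F : (Fin d → Fin (n + 1)) → ℂ) :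
    cvar (xsl (n := n) k σ μ) F ≤ (n : ℝ) * (n + 1) / 2 * dirOn (xsl (n := n) k σ μ) F := by
  unfold xsl; cases σ μ
  · exact cvar_lo_le μ k hk F
  · exact cvar_hi_le μ k hk F

/-- slab Poincaré for the far slab. [folklore] -/
theorem cvar_fsl_le (hk : 4 * k = n + 1) (μ : Fin d) (F : (Fin d → Fin (n + 1)) → ℂ) :
    cvar (fsl (n := n) k σ μ) F ≤ (n : ℝ) * (n + 1) / 2 * dirOn (fsl (n := n) k σ μ) F := by
  unfold fsl; cases σ μ
  · exact cvar_hi_le μ k hk F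
  · exact cvar_lo_le μ k hk F

/-- one slab form is at most the sum of all. [folklore] -/
theorem dirOn_xsl_le (μ : Fin d) (F : (Fin d → Fin (n + 1)) → ℂ) : dirOn (xsl (n := n) k σ μ) F ≤ slabDir (n := n) k F := by
  have h : dirOn (lo (n := n) μ k) F + dirOn (hi (n := n) μ k) F ≤ slabDir (n := n) k F :=
    Finset.single_le_sum (f := fun μ => dirOn (lo (n := n) μ k) F + dirOn (hi (n := n) μ k) F)
      (fun μ _ => add_nonneg (dirOn_nonneg _ _) (dirOn_nonneg _ _)) (mem_univ μ)
  have h1 := dirOn_nonneg (lo (n := n) μ k) F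
  have h2 := dirOn_nonneg (hi (n := n) μ k) F
  unfold xsl; cases σ μ
  · simp only [Bool.false_eq_true, if_false]; linarith
  · simp only [if_true]; linarith

/-- one slab form is at most the sum of all. [folklore] -/
theorem dirOn_fsl_le (μ : Fin d) (F : (Fin d → Fin (n + 1)) → ℂ) : dirOn (fsl (n := n) k σ μ) F ≤ slabDir (n := n) k F := by
  have h : dirOn (lo (n := n) μ k) F + dirOn (hi (n := n) μ k) F ≤ slabDir (n := n) k F :=
    Finset.single_le_sum (f := fun μ => dirOn (lo (n := n) μ k) F + dirOn (hi (n := n) μ k) F)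
      (fun μ _ => add_nonneg (dirOn_nonneg _ _) (dirOn_nonneg _ _)) (mem_univ μ)
  have h1 := dirOn_nonneg (lo (n := n) μ k) F
  have h2 := dirOn_nonneg (hi (n := n) μ k) F
  unfold fsl; cases σ μ
  · simp only [Bool.false_eq_true, if_false]; linarith
  · simp only [if_true]; linarith

/-- `octT μ ⊆ xsl μ`. [folklore] -/
theorem octT_subset_xsl (μ : Fin d) : octT (n := n) k σ μ ⊆ xsl (n := n) k σ μ := by
  intro y hy
  rw [octT, Fintype.mem_piFinset] at hy
  have h := hy μ
  rw [if_pos rfl] at h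
  unfold xsl; revert h
  cases σ μ <;> simp [xq, qHi, qLo, mem_lo, mem_hi]

/-- `octW μ ν ⊆ fsl μ`. [folklore] -/
theorem octW_subset_fsl (μ ν : Fin d) : octW (n := n) k σ μ ν ⊆ fsl (n := n) k σ μ := by
  intro y hy
  rw [octW, Fintype.mem_piFinset] at hy
  have h := hy μ
  rw [if_pos rfl] at h
  unfold fsl; revert h
  cases σ μ <;> simp [fq, qHi, qLo, mem_lo, mem_hi]

/-- `octW μ ν ⊆ xsl ν` (`μ ≠ ν`). [folklore] -/
theorem octW_subset_xsl {μ ν : Fin d} (hμν : μ ≠ ν) : octW (n := n) k σ μ ν ⊆ xsl (n := n) k σ ν := by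
  intro y hy
  rw [octW, Fintype.mem_piFinset] at hy
  have h := hy ν
  rw [if_neg (Ne.symm hμν), if_pos rfl] at h
  unfold xsl; revert h
  cases σ ν <;> simp [xq, qHi, qLo, mem_lo, mem_hi]

omit k σ in
/-- any set of sites has at most `(n+1)^d` elements. [folklore] -/
theorem card_le_cube (S : Finset (Fin d → Fin (n + 1))) : (S.card : ℝ) ≤ ((n : ℝ) + 1) ^ d := by
  have h := Finset.card_le_univ S
  rw [card_cube] at h
  exact_mod_cast h

/-- the ratio `|S|/|octT| ≤ 2^{d+1}`. [folklore] -/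
theorem ratio_octT_le (hk : 4 * k = n + 1) (μ : Fin d) (S : Finset (Fin d → Fin (n + 1))) :
    (S.card : ℝ) / (octT (n := n) k σ μ).card ≤ 2 ^ (d + 1) := by
  have hkpos : (0 : ℝ) < k := by exact_mod_cast (show 0 < k by omega)
  have hT : ((octT (n := n) k σ μ).card : ℝ) * 2 = (2 * (k : ℝ)) ^ d := by exact_mod_cast card_octT k σ hk μ
  have hTpos : (0 : ℝ) < (octT (n := n) k σ μ).card := by
    have : (0 : ℝ) < (2 * (k : ℝ)) ^ d := by positivity
    nlinarith
  rw [div_le_iff₀ hTpos]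
  calc (S.card : ℝ) ≤ ((n : ℝ) + 1) ^ d := card_le_cube S
    _ = 2 ^ d * (2 * (k : ℝ)) ^ d := pow_cube_eq hk
    _ = 2 ^ (d + 1) * (octT (n := n) k σ μ).card := by rw [← hT, pow_succ]; ring

/-- the ratio `|S|/|octW| ≤ 16` (`μ ≠ ν`). [folklore] -/
theorem ratio_octW_le (hk : 4 * k = n + 1) {μ ν : Fin d} (hμν : μ ≠ ν) (S : Finset (Fin d → Fin (n + 1))) :
    (S.card : ℝ) / (octW (n := n) k σ μ ν).card ≤ 16 := by
  have hW : ((octW (n := n) k σ μ ν).card : ℝ) * 16 = ((n : ℝ) + 1) ^ d := by exact_mod_cast card_octW k σ hk hμν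
  have hWpos : (0 : ℝ) < (octW (n := n) k σ μ ν).card := by
    have : (0 : ℝ) < ((n : ℝ) + 1) ^ d := by positivity
    nlinarith
  rw [div_le_iff₀ hWpos]
  calc (S.card : ℝ) ≤ ((n : ℝ) + 1) ^ d := card_le_cube S
    _ = 16 * (octW (n := n) k σ μ ν).card := by rw [← hW]; ring

/-- nonemptiness of `octT`. [folklore] -/
theorem octT_nonempty (hk : 4 * k = n + 1) (μ : Fin d) : (octT (n := n) k σ μ).Nonempty := by
  rw [← Finset.card_pos]
  have h := card_octT k σ hk μ
  have hk0 : 0 < k := by omega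
  have : 0 < (2 * k) ^ d := by positivity
  omega

/-- nonemptiness of `octW` (`μ ≠ ν`). [folklore] -/
theorem octW_nonempty (hk : 4 * k = n + 1) {μ ν : Fin d} (hμν : μ ≠ ν) : (octW (n := n) k σ μ ν).Nonempty := by
  rw [← Finset.card_pos]
  have h := card_octW k σ hk hμν
  have : 0 < (n + 1) ^ d := by positivity
  omega

/-- MASS ON A σ-SIDE SLAB: `Σ_{xsl μ} ‖F‖² ≤ (1 + 2^{d+1})·P·slabDir`. [folklore] -/
theorem mass_xsl_le (hk : 4 * k = n + 1) (μ : Fin d) (F : (Fin d → Fin (n + 1)) → ℂ) (hF : ∀ y ∈ oct (n := n) k σ, F y = 0) :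
    ∑ y ∈ xsl (n := n) k σ μ, ‖F y‖ ^ 2 ≤ (1 + 2 ^ (d + 1)) * ((n : ℝ) * (n + 1) / 2) * slabDir (n := n) k F := by
  have hT := octT_subset_xsl (n := n) k σ μ
  have hz : ∀ y ∈ octT (n := n) k σ μ, F y = 0 := fun y hy => hF y (octT_subset_oct k σ hk μ hy)
  have h1 := sum_norm_sq_le_of_vanish hT (octT_nonempty k σ hk μ) hz
  have h2 := ratio_octT_le k σ hk μ (xsl (n := n) k σ μ)
  have h3 := cvar_xsl_le k σ hk μ F
  have h4 := dirOn_xsl_le k σ μ F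
  have hP : (0 : ℝ) ≤ (n : ℝ) * (n + 1) / 2 := by positivity
  have hc := cvar_nonneg (xsl (n := n) k σ μ) F
  calc ∑ y ∈ xsl (n := n) k σ μ, ‖F y‖ ^ 2 ≤ (1 + ((xsl (n := n) k σ μ).card : ℝ) / (octT (n := n) k σ μ).card) * cvar (xsl k σ μ) F := h1
    _ ≤ (1 + 2 ^ (d + 1)) * cvar (xsl (n := n) k σ μ) F := by nlinarith
    _ ≤ (1 + 2 ^ (d + 1)) * ((n : ℝ) * (n + 1) / 2 * slabDir (n := n) k F) := by
        refine mul_le_mul_of_nonneg_left (h3.trans (mul_le_mul_of_nonneg_left h4 hP)) (by positivity)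
    _ = _ := by ring

/-- MASS ON A FAR SLAB, glued to the σ-side slab of another direction `ν ≠ μ`:
`Σ_{fsl μ} ‖F‖² ≤ (132 + 2^{d+2})·P·slabDir`. [folklore] -/
theorem mass_fsl_le (hk : 4 * k = n + 1) {μ ν : Fin d} (hμν : μ ≠ ν) (F : (Fin d → Fin (n + 1)) → ℂ)
    (hF : ∀ y ∈ oct (n := n) k σ, F y = 0) :
    ∑ y ∈ fsl (n := n) k σ μ, ‖F y‖ ^ 2 ≤ (132 + 2 ^ (d + 2)) * ((n : ℝ) * (n + 1) / 2) * slabDir (n := n) k F := by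
  have hz : ∀ y ∈ octT (n := n) k σ ν, F y = 0 := fun y hy => hF y (octT_subset_oct k σ hk ν hy)
  have h1 := sum_norm_sq_le_of_gluing (octW_subset_xsl (n := n) k σ hμν) (octW_subset_fsl (n := n) k σ μ ν)
    (octW_nonempty k σ hk hμν) (octT_subset_xsl (n := n) k σ ν) (octT_nonempty k σ hk ν) hz
  have hrW := ratio_octW_le k σ hk hμν (fsl (n := n) k σ μ)
  have hrT := ratio_octT_le k σ hk ν (fsl (n := n) k σ μ)
  have hU := cvar_xsl_le k σ hk ν F
  have hV := cvar_fsl_le k σ hk μ F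
  have hU' := dirOn_xsl_le k σ ν F
  have hV' := dirOn_fsl_le k σ μ F
  have hP : (0 : ℝ) ≤ (n : ℝ) * (n + 1) / 2 := by positivity
  have hcU := cvar_nonneg (xsl (n := n) k σ ν) F
  have hcV := cvar_nonneg (fsl (n := n) k σ μ) F
  set P := (n : ℝ) * (n + 1) / 2
  set D := slabDir (n := n) k F
  have hUD : cvar (xsl (n := n) k σ ν) F ≤ P * D := hU.trans (mul_le_mul_of_nonneg_left hU' hP)
  have hVD : cvar (fsl (n := n) k σ μ) F ≤ P * D := hV.trans (mul_le_mul_of_nonneg_left hV' hP)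
  have hr0 : (0 : ℝ) ≤ ((fsl (n := n) k σ μ).card : ℝ) / (octW (n := n) k σ μ ν).card := by positivity
  have hr1 : (0 : ℝ) ≤ ((fsl (n := n) k σ μ).card : ℝ) / (octT (n := n) k σ ν).card := by positivity
  calc ∑ y ∈ fsl (n := n) k σ μ, ‖F y‖ ^ 2
      ≤ 2 * (1 + 2 * ((fsl (n := n) k σ μ).card : ℝ) / (octW (n := n) k σ μ ν).card) * (cvar (xsl k σ ν) F + cvar (fsl k σ μ) F)
        + 2 * (((fsl (n := n) k σ μ).card : ℝ) / (octT (n := n) k σ ν).card) * cvar (xsl k σ ν) F := h1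
    _ ≤ 2 * (1 + 2 * 16) * (P * D + P * D) + 2 * 2 ^ (d + 1) * (P * D) := by
        have e1 : 2 * ((fsl (n := n) k σ μ).card : ℝ) / (octW (n := n) k σ μ ν).card ≤ 2 * 16 := by
          rw [mul_div_assoc]; linarith
        nlinarith
    _ = (132 + 2 ^ (d + 2)) * P * D := by ring

/-- the constant of the annulus inequality. [folklore] -/
def annConst (d : ℕ) : ℝ := d * (133 + 6 * 2 ^ d)

/-- **THE ANNULUS WITH A VANISHING OCTANT**: for `d ≥ 2`, `4k = n + 1` and `F = 0` on `oct σ k`,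
`Σ_μ (Σ_{lo μ k} ‖F‖² + Σ_{hi μ k} ‖F‖²) ≤ annConst d · (n(n+1)/2) · slabDir k F`. [folklore] -/
theorem annulus_mass_le (hd : 2 ≤ d) (hk : 4 * k = n + 1) (F : (Fin d → Fin (n + 1)) → ℂ) (hF : ∀ y ∈ oct (n := n) k σ, F y = 0) :
    ∑ μ : Fin d, (∑ y ∈ lo (n := n) μ k, ‖F y‖ ^ 2 + ∑ y ∈ hi (n := n) μ k, ‖F y‖ ^ 2)
      ≤ annConst d * ((n : ℝ) * (n + 1) / 2) * slabDir (n := n) k F := by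
  set P := (n : ℝ) * (n + 1) / 2 with hPdef
  set D := slabDir (n := n) k F with hDdef
  have hP : 0 ≤ P := by positivity
  have hD : 0 ≤ D := slabDir_nonneg k F
  have hper : ∀ μ : Fin d, ∑ y ∈ lo (n := n) μ k, ‖F y‖ ^ 2 + ∑ y ∈ hi (n := n) μ k, ‖F y‖ ^ 2 ≤ (133 + 6 * 2 ^ d) * P * D := by
    intro μ
    -- in dimension `d ≥ 2` every direction has another one (the tree's `…ShellMeasurePlaquetteStarClosure.exists_ne`, kept local)
    obtain ⟨ν, hμν⟩ : ∃ ν : Fin d, μ ≠ ν := by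
      by_cases h : (μ : ℕ) = 0
      · exact ⟨⟨1, by omega⟩, fun e => by have := congrArg Fin.val e; simp at this; omega⟩
      · exact ⟨⟨0, by omega⟩, fun e => by have := congrArg Fin.val e; simp at this; omega⟩
    rw [mass_lo_add_hi k σ μ F]
    have h1 := mass_xsl_le k σ hk μ F hF
    have h2 := mass_fsl_le k σ hk hμν F hF
    rw [← hPdef, ← hDdef] at h1 h2
    have e : (1 + 2 ^ (d + 1)) * P * D + (132 + 2 ^ (d + 2)) * P * D = (133 + 6 * 2 ^ d) * P * D := by ring
    linarith
  calc ∑ μ : Fin d, (∑ y ∈ lo (n := n) μ k, ‖F y‖ ^ 2 + ∑ y ∈ hi (n := n) μ k, ‖F y‖ ^ 2)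
      ≤ ∑ μ : Fin d, (133 + 6 * 2 ^ d) * P * D := Finset.sum_le_sum fun μ _ => hper μ
    _ = annConst d * P * D := by rw [Finset.sum_const, Finset.card_univ, Fintype.card_fin, nsmul_eq_mul, annConst]; ring

end Annulus

/-! ## §4 Slab bonds are annulus bonds: the slab forms are paid by the energy outside the inner cube -/

section Bonds

variable (k : ℕ)

/-- the INNER cube `[k, 3k)^d = {y : ∀ λ, k ≤ y λ ∧ y λ + k < n + 1}`. [folklore] -/
def inner : Finset (Fin d → Fin (n + 1)) := univ.filter (fun y : Fin d → Fin (n + 1) => ∀ lam, k ≤ (y lam : ℕ) ∧ (y lam : ℕ) + k < n + 1)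

/-- membership in the inner cube. [folklore] -/
theorem mem_inner {y : Fin d → Fin (n + 1)} : y ∈ inner (n := n) k ↔ ∀ lam, k ≤ (y lam : ℕ) ∧ (y lam : ℕ) + k < n + 1 := by
  simp [inner]

omit k in
/-- a `ν`-term as an indicator sum over `{y ν ≠ last}`. [folklore] -/
theorem dirTerm_eq_ite (S : Finset (Fin d → Fin (n + 1))) (F : (Fin d → Fin (n + 1)) → ℂ) (ν : Fin d) :
    dirTerm S F ν = ∑ y ∈ univ.filter (fun y : Fin d → Fin (n + 1) => y ν ≠ Fin.last n),
      (if y ∈ S ∧ stepUp y ν ∈ S then ‖F (stepUp y ν) - F y‖ ^ 2 else 0) := by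
  rw [dirTerm, ← Finset.sum_filter, Finset.filter_filter]

/-- **SLAB FORMS ≤ d·(ENERGY OUTSIDE THE INNER CUBE)**: `Σ_μ (dirOn (lo μ k) F + dirOn (hi μ k) F) ≤ d·(dirOn univ F − dirOn (inner k) F)`
(for `4k = n + 1`): a slab bond is not an inner bond, the two slabs of one direction are disjoint, and a bond lies in at most `d` slabs. [folklore] -/
theorem slabs_dir_le (hk : 4 * k = n + 1) (F : (Fin d → Fin (n + 1)) → ℂ) :
    slabDir (n := n) k F ≤ d * (dirOn univ F - dirOn (inner (n := n) k) F) := by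
  have hL : slabDir (n := n) k F = ∑ ν : Fin d, ∑ μ : Fin d, (dirTerm (lo (n := n) μ k) F ν + dirTerm (hi (n := n) μ k) F ν) := by
    unfold slabDir
    simp only [dirOn_eq_sum_dirTerm, ← Finset.sum_add_distrib]
    exact Finset.sum_comm
  have hR : (d : ℝ) * (dirOn univ F - dirOn (inner (n := n) k) F)
      = ∑ ν : Fin d, (d : ℝ) * (dirTerm univ F ν - dirTerm (inner (n := n) k) F ν) := by
    simp only [dirOn_eq_sum_dirTerm]
    rw [← Finset.sum_sub_distrib, Finset.mul_sum]
  rw [hL, hR]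
  refine Finset.sum_le_sum fun ν _ => ?_
  -- per direction `ν`, pointwise in the bond base point `y`
  have key : ∀ μ : Fin d, dirTerm (lo (n := n) μ k) F ν + dirTerm (hi (n := n) μ k) F ν
      = ∑ y ∈ univ.filter (fun y : Fin d → Fin (n + 1) => y ν ≠ Fin.last n),
        ((if y ∈ lo (n := n) μ k ∧ stepUp y ν ∈ lo (n := n) μ k then ‖F (stepUp y ν) - F y‖ ^ 2 else 0)
          + (if y ∈ hi (n := n) μ k ∧ stepUp y ν ∈ hi (n := n) μ k then ‖F (stepUp y ν) - F y‖ ^ 2 else 0)) := by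
    intro μ; rw [dirTerm_eq_ite, dirTerm_eq_ite, ← Finset.sum_add_distrib]
  have key2 : (d : ℝ) * (dirTerm univ F ν - dirTerm (inner (n := n) k) F ν)
      = ∑ y ∈ univ.filter (fun y : Fin d → Fin (n + 1) => y ν ≠ Fin.last n), (d : ℝ) *
        ((if y ∈ (univ : Finset (Fin d → Fin (n + 1))) ∧ stepUp y ν ∈ (univ : Finset (Fin d → Fin (n + 1)))
            then ‖F (stepUp y ν) - F y‖ ^ 2 else 0)
          - (if y ∈ inner (n := n) k ∧ stepUp y ν ∈ inner (n := n) k then ‖F (stepUp y ν) - F y‖ ^ 2 else 0)) := by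
    rw [dirTerm_eq_ite, dirTerm_eq_ite, ← Finset.sum_sub_distrib, Finset.mul_sum]
  rw [Finset.sum_congr rfl (fun μ _ => key μ), key2, Finset.sum_comm]
  refine Finset.sum_le_sum fun y _ => ?_
  set w := ‖F (stepUp y ν) - F y‖ ^ 2 with hw
  have hw0 : 0 ≤ w := sq_nonneg _
  have huniv : (if y ∈ (univ : Finset (Fin d → Fin (n + 1))) ∧ stepUp y ν ∈ (univ : Finset (Fin d → Fin (n + 1))) then w else 0) = w := by
    simp
  rw [huniv]
  by_cases hin : y ∈ inner (n := n) k ∧ stepUp y ν ∈ inner (n := n) k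
  · -- an inner bond lies in no slab
    rw [if_pos hin]
    have hy := (mem_inner k).mp hin.1
    have hzero : ∀ μ : Fin d, ((if y ∈ lo (n := n) μ k ∧ stepUp y ν ∈ lo (n := n) μ k then w else 0)
        + (if y ∈ hi (n := n) μ k ∧ stepUp y ν ∈ hi (n := n) μ k then w else 0)) = 0 := by
      intro μ
      have h1 : ¬ (y ∈ lo (n := n) μ k ∧ stepUp y ν ∈ lo (n := n) μ k) := by
        rintro ⟨h, _⟩; rw [mem_lo] at h; have := (hy μ).1; omega
      have h2 : ¬ (y ∈ hi (n := n) μ k ∧ stepUp y ν ∈ hi (n := n) μ k) := by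
        rintro ⟨h, _⟩; rw [mem_hi] at h; have := (hy μ).2; omega
      rw [if_neg h1, if_neg h2, add_zero]
    rw [Finset.sum_congr rfl fun μ _ => hzero μ, Finset.sum_const_zero, sub_self, mul_zero]
  · rw [if_neg hin, sub_zero]
    have hle : ∀ μ : Fin d, ((if y ∈ lo (n := n) μ k ∧ stepUp y ν ∈ lo (n := n) μ k then w else 0)
        + (if y ∈ hi (n := n) μ k ∧ stepUp y ν ∈ hi (n := n) μ k then w else 0)) ≤ w := by
      intro μ
      by_cases h1 : y ∈ lo (n := n) μ k ∧ stepUp y ν ∈ lo (n := n) μ k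
      · have h2 : ¬ (y ∈ hi (n := n) μ k ∧ stepUp y ν ∈ hi (n := n) μ k) := by
          rintro ⟨h, _⟩; have h1' := h1.1; rw [mem_lo] at h1'; rw [mem_hi] at h; omega
        rw [if_pos h1, if_neg h2, add_zero]
      · rw [if_neg h1, zero_add]; split_ifs <;> linarith
    calc ∑ μ : Fin d, ((if y ∈ lo (n := n) μ k ∧ stepUp y ν ∈ lo (n := n) μ k then w else 0)
          + (if y ∈ hi (n := n) μ k ∧ stepUp y ν ∈ hi (n := n) μ k then w else 0))
        ≤ ∑ μ : Fin d, w := Finset.sum_le_sum fun μ _ => hle μ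
      _ = d * w := by rw [Finset.sum_const, Finset.card_univ, Fintype.card_fin, nsmul_eq_mul]

end Bonds

end Summit.QuantumFields.BalabanUV.T4Continuum.CoordAnnulusPoincare

end
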